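import Mathlib
import Summits.MatrixMultiplication.MatrixMultiplication.Theorems.HiddenToeplitzCornersHiddenCornerLemmaRCapacityIneq
import Summits.MatrixMultiplication.MatrixMultiplication.Theorems.HiddenToeplitzCornersHiddenCornerLemmaRStripEndgamePos
import Summits.MatrixMultiplication.MatrixMultiplication.Theorems.HiddenToeplitzCornersHiddenCornerLemmaRStein
import Summits.MatrixMultiplication.MatrixMultiplication.Theorems.HiddenToeplitzCornersHiddenCornerLemmaRCapacityBasic
import Summits.MatrixMultiplication.MatrixMultiplication.Theorems.HiddenToeplitzCornersHiddenCornerLemmaRCapacityKrylov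
import Summits.MatrixMultiplication.MatrixMultiplication.Theorems.HiddenToeplitzCornersHiddenCornerLemmaRCapacityPoly
import Summits.MatrixMultiplication.MatrixMultiplication.Theorems.HiddenToeplitzCornersHiddenCornerLemmaRCapacityAct
import Summits.MatrixMultiplication.MatrixMultiplication.Theorems.HiddenToeplitzCornersHiddenCornerLemmaRCapacityDict
import Summits.MatrixMultiplication.MatrixMultiplication.Theorems.HiddenToeplitzCornersHiddenCornerLemmaRStripMatrix
import Summits.MatrixMultiplication.MatrixMultiplication.Theorems.HiddenToeplitzCornersHiddenCornerLemmaRStripOrth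
import Summits.MatrixMultiplication.MatrixMultiplication.Theorems.HiddenToeplitzCornersHiddenCornerLemmaRStripRank
import Summits.MatrixMultiplication.MatrixMultiplication.Theorems.HiddenToeplitzCornersHiddenCornerLemmaRKrylovTransfer

/-!
# The G-const dual law for strip generators (the strip theorem)

Final assembly (step S-g of `math/STRIP_THEOREM.md`) for crux item `stmt-MatrixMultiplication-10752`,
line `frobenius-dual-short-syzygies`, stub `stub_gconstDualLaw` restricted to STRIP generators
`G₀ i k = [i = c k]` with strictly increasing in-range cut rows `c`.
-/

set_option linter.dupNamespace false

namespace Summit.MatrixMultiplication.MatrixMultiplication.Theorems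

open Polynomial
open scoped Matrix




/-! ### Strip rows of `M`: shifting the argument moves along the strip -/

variable {N p : ℕ}

/-- Inside one strip the rows of `M` are shifts of each other: if no cut row lies in
`(i, i + m'']`, then `(M ((Zᵀ)^m'' y)) i = (M y) (i + m'')`. -/
theorem hclR_fin_strip_row_shift (c : Fin p → ℕ) (M : Matrix (Fin N) (Fin N) ℂ)
    (H : Matrix (Fin N) (Fin p) ℂ)
    (hM : M - (Matrix.of fun i j : Fin N => if (i : ℕ) = (j : ℕ) + 1 then (1 : ℂ) else 0) * M *
      ((Matrix.of fun i j : Fin N => if (i : ℕ) = (j : ℕ) + 1 then (1 : ℂ) else 0))ᵀ =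
      (Matrix.of fun (i : Fin N) (k : Fin p) => if (i : ℕ) = c k then (1 : ℂ) else 0) * Hᵀ)
    (y : Fin N → ℂ) (i i' : Fin N) (m'' : ℕ) (hi' : (i' : ℕ) = i + m'')
    (hgap : ∀ k, c k ≤ (i' : ℕ) → c k ≤ (i : ℕ)) :
    (M *ᵥ ((((Matrix.transpose (Matrix.of fun i j : Fin (N) => if (i : ℕ) = (j : ℕ) + 1 then (1 : ℂ) else 0)))) ^ m'' *ᵥ y)) i = (M *ᵥ y) i' := by
  rw [hclR_strip_mulVec N p c M H hM, hclR_strip_mulVec N p c M H hM]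
  refine Finset.sum_congr rfl (fun k _ => ?_)
  by_cases hk : c k ≤ (i : ℕ)
  · have hk' : c k ≤ (i' : ℕ) := by omega
    rw [if_pos hk, if_pos hk', Matrix.mulVec_mulVec, ← pow_add]
    congr 3
    omega
  · have hk' : ¬ c k ≤ (i' : ℕ) := fun h => hk (hgap k h)
    rw [if_neg hk, if_neg hk']

/-! ### Junk strips: the rows of `M` vanish on the frame columns -/

variable {r : ℕ}

/-- `(M *ᵥ col_{c'} E) i = (M * E) i c'`. -/
theorem hclR_fin_mulVec_col (M : Matrix (Fin N) (Fin N) ℂ) (E : Matrix (Fin N) (Fin r) ℂ)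
    (i : Fin N) (c' : Fin r) : (M *ᵥ (fun n => E n c')) i = (M * E) i c' := by
  simp [Matrix.mulVec, dotProduct, Matrix.mul_apply]

/-- In a junk strip (`S_{w_k}` is all of `degreeLT w_k`) the strip block of `F` vanishes (G1 + G3),
hence the strip rows of `M` kill every frame column (`M E = F X₀`). -/
theorem hclR_fin_junk_row (c : Fin p → ℕ) (E F : Matrix (Fin N) (Fin r) ℂ)
    (M : Matrix (Fin N) (Fin N) ℂ) (X₀ : Matrix (Fin r) (Fin r) ℂ)
    (hann : ∀ Λ : Matrix (Fin N) (Fin r) ℂ,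
      (∀ k : Fin p,
        (∑ c' : Fin r,
          (∑ j : Fin N,
            (((∑ i : Fin N, (Matrix.of fun (i : Fin N) (k : Fin p) => if (i : ℕ) = c k then (1 : ℂ) else 0) i k •
                (((Matrix.transpose (Matrix.of fun i j : Fin (N) => if (i : ℕ) = (j : ℕ) + 1 then (1 : ℂ) else 0)))) ^ (i : ℕ)) *ᵥ (Λᵀ c')) j) • (((Matrix.transpose (Matrix.of fun i j : Fin (N) => if (i : ℕ) = (j : ℕ) + 1 then (1 : ℂ) else 0)))) ^ (j : ℕ)) *ᵥ (Eᵀ c')) = 0) →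
      Λᵀ * F = 0)
    (hME : M * E = F * X₀) (k : Fin p) (wk : ℕ) (hwk : c k + wk ≤ N)
    (hgap : ∀ k' : Fin p, c k < c k' → c k + wk ≤ c k')
    (hjunk : (⨆ b : Fin r, Submodule.map (LinearMap.proj b : (Fin r → Polynomial ℂ) →ₗ[ℂ] Polynomial ℂ) (LinearMap.ker (∑ c : Fin r, LinearMap.comp (Polynomial.lsum (fun (i : ℕ) => LinearMap.smulRight (LinearMap.id : ℂ →ₗ[ℂ] ℂ) (Polynomial.divX^[i] ((fun c' => (((Polynomial.degreeLT ℂ (N)).subtype ∘ₗ (Polynomial.degreeLTEquiv ℂ (N)).symm.toLinearMap : (Fin (N) → ℂ) →ₗ[ℂ] Polynomial ℂ)) (fun n => (E : Matrix (Fin N) (Fin r) ℂ) n c')) c : Polynomial ℂ))) : Polynomial ℂ →ₗ[ℂ] Polynomial ℂ) (LinearMap.proj c : (Fin r → Polynomial ℂ) →ₗ[ℂ] Polynomial ℂ)) ⊓ (Submodule.pi Set.univ (fun _ : Fin r => Polynomial.degreeLT ℂ (wk)) : Submodule ℂ (Fin r → Polynomial ℂ)))) = Polynomial.degreeLT ℂ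 wk) (m : ℕ) (hm : m < wk) (c' : Fin r) :
    (M *ᵥ (fun n => E n c')) ⟨c k + m, by omega⟩ = 0 := by
  rw [hclR_fin_mulVec_col, hME, Matrix.mul_apply]
  refine Finset.sum_eq_zero (fun a _ => ?_)
  have hG3 := hclR_strip_junk_block_zero r N E F (c k) wk hwk
    (fun α hα b a => hclR_strip_block_orth r N p c E F hann k wk hwk hgap α hα b a) hjunk ⟨m, hm⟩ a
  rw [hG3, zero_mul]

/-! ### The junk-row count (II) -/

/-- **(II)** For a set `J` of junk strips and a level `1 ≤ wstar ≤ w_k` (`k ∈ J`), the rows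
`c_k + m`, `k ∈ J`, `m ≤ w_k - wstar`, of the nonsingular `M` annihilate the vector Krylov space of
level `wstar`; hence `Σ_{k ∈ J} (w_k + 1 - wstar) + κ_{wstar} ≤ N`. -/
theorem hclR_fin_junk_count (c : Fin p → ℕ) (E F : Matrix (Fin N) (Fin r) ℂ)
    (M : Matrix (Fin N) (Fin N) ℂ) (H : Matrix (Fin N) (Fin p) ℂ) (X₀ : Matrix (Fin r) (Fin r) ℂ)
    (hann : ∀ Λ : Matrix (Fin N) (Fin r) ℂ,
      (∀ k : Fin p,
        (∑ c' : Fin r,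
          (∑ j : Fin N,
            (((∑ i : Fin N, (Matrix.of fun (i : Fin N) (k : Fin p) => if (i : ℕ) = c k then (1 : ℂ) else 0) i k •
                (((Matrix.transpose (Matrix.of fun i j : Fin (N) => if (i : ℕ) = (j : ℕ) + 1 then (1 : ℂ) else 0)))) ^ (i : ℕ)) *ᵥ (Λᵀ c')) j) • (((Matrix.transpose (Matrix.of fun i j : Fin (N) => if (i : ℕ) = (j : ℕ) + 1 then (1 : ℂ) else 0)))) ^ (j : ℕ)) *ᵥ (Eᵀ c')) = 0) →
      Λᵀ * F = 0)
    (hM : M - (Matrix.of fun i j : Fin N => if (i : ℕ) = (j : ℕ) + 1 then (1 : ℂ) else 0) * M *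
      ((Matrix.of fun i j : Fin N => if (i : ℕ) = (j : ℕ) + 1 then (1 : ℂ) else 0))ᵀ =
      (Matrix.of fun (i : Fin N) (k : Fin p) => if (i : ℕ) = c k then (1 : ℂ) else 0) * Hᵀ)
    (hME : M * E = F * X₀) (hdet : M.det ≠ 0) (hc : StrictMono c) (w : Fin p → ℕ)
    (hw : ∀ k, c k + w k ≤ N) (hgap : ∀ k k' : Fin p, c k < c k' → c k + w k ≤ c k') (hN0 : 0 < N)
    (J : Finset (Fin p)) (hJ : ∀ k ∈ J, (⨆ b : Fin r, Submodule.map (LinearMap.proj b : (Fin r → Polynomial ℂ) →ₗ[ℂ] Polynomial ℂ) (LinearMap.ker (∑ c : Fin r, LinearMap.comp (Polynomial.lsum (fun (i : ℕ) => LinearMap.smulRight (LinearMap.id : ℂ →ₗ[ℂ] ℂ) (Polynomial.divX^[i] ((fun c' => (((Polynomial.degreeLT ℂ (N)).subtype ∘ₗ (Polynomial.degreeLTEquiv ℂ (N)).symm.toLinearMap : (Fin (N) → ℂ) →ₗ[ℂ] Polynomial ℂ)) (fun n => (E : Matrix (Fin N) (Fin r) ℂ) n c')) c : Polynomial ℂ)))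 : Polynomial ℂ →ₗ[ℂ] Polynomial ℂ) (LinearMap.proj c : (Fin r → Polynomial ℂ) →ₗ[ℂ] Polynomial ℂ)) ⊓ (Submodule.pi Set.univ (fun _ : Fin r => Polynomial.degreeLT ℂ (w k)) : Submodule ℂ (Fin r → Polynomial ℂ)))) = Polynomial.degreeLT ℂ (w k))
    (wstar : ℕ) (hws : 1 ≤ wstar) (hle : ∀ k ∈ J, wstar ≤ w k) :
    (∑ k ∈ J, (w k + 1 - wstar)) + Module.finrank ℂ ↥((Submodule.span ℂ (Set.range (fun p : Fin (r) × Fin (wstar) => Polynomial.divX^[(Prod.snd p).val] (((fun c' => (((Polynomial.degreeLT ℂ (N)).subtype ∘ₗ (Polynomial.degreeLTEquiv ℂ (N)).symm.toLinearMap : (Fin (N) → ℂ) →ₗ[ℂ] Polynomial ℂ)) (fun n => (E : Matrix (Fin N) (Fin r) ℂ) n c')) : Fin r → Polynomial ℂ) (Prod.fst p)))))) ≤ N := by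
  classical
  -- the junk rows, strip by strip
  set S : Fin p → Finset (Fin N) := fun k =>
    (Finset.range (w k + 1 - wstar)).image (fun m : ℕ => (⟨min (c k + m) (N - 1), by omega⟩ : Fin N))
    with hSdef
  have hSmem : ∀ k ∈ J, ∀ i : Fin N, i ∈ S k ↔ ∃ m, m < w k + 1 - wstar ∧ (i : ℕ) = c k + m := by
    intro k hk i
    simp only [hSdef, Finset.mem_image, Finset.mem_range]
    constructor
    · rintro ⟨m, hm, rfl⟩
      refine ⟨m, hm, ?_⟩
      have := hle k hk; have := hw k
      dsimp only at *
      omega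
    · rintro ⟨m, hm, hi⟩
      refine ⟨m, hm, Fin.ext ?_⟩
      have := hle k hk; have := hw k
      dsimp only
      omega
  have hScard : ∀ k ∈ J, (S k).card = w k + 1 - wstar := by
    intro k hk
    rw [hSdef, Finset.card_image_of_injOn, Finset.card_range]
    intro m hm m' hm' hmm
    simp only [Finset.coe_range, Set.mem_Iio] at hm hm'
    have := hle k hk; have := hw k
    have h := congrArg Fin.val hmm
    dsimp only at h
    omega
  -- strips are disjoint
  have hdisj : (J : Set (Fin p)).PairwiseDisjoint S := by
    intro k hk k' hk' hkk'
    rw [Function.onFun, Finset.disjoint_left]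
    intro i hi hi'
    obtain ⟨m, hm, him⟩ := (hSmem k hk i).1 hi
    obtain ⟨m', hm', him'⟩ := (hSmem k' hk' i).1 hi'
    have := hle k hk; have := hle k' hk'
    rcases lt_or_gt_of_ne hkk' with h | h
    · have := hgap k k' (hc h); omega
    · have := hgap k' k (hc h); omega
  set I : Finset (Fin N) := J.biUnion S with hIdef
  have hIcard : I.card = ∑ k ∈ J, (w k + 1 - wstar) := by
    rw [hIdef, Finset.card_biUnion hdisj]
    exact Finset.sum_congr rfl hScard
  -- the vector Krylov space of level `wstar`
  set W : Submodule ℂ (Fin N → ℂ) := Submodule.span ℂ (Set.range (fun q : Fin r × Fin wstar =>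
      (((Matrix.transpose (Matrix.of fun i j : Fin (N) => if (i : ℕ) = (j : ℕ) + 1 then (1 : ℂ) else 0)))) ^ (q.2 : ℕ) *ᵥ (fun n => E n q.1))) with hWdef
  have hW : Module.finrank ℂ ↥W = Module.finrank ℂ ↥((Submodule.span ℂ (Set.range (fun p : Fin (r) × Fin (wstar) => Polynomial.divX^[(Prod.snd p).val] (((fun c' => (((Polynomial.degreeLT ℂ (N)).subtype ∘ₗ (Polynomial.degreeLTEquiv ℂ (N)).symm.toLinearMap : (Fin (N) → ℂ) →ₗ[ℂ] Polynomial ℂ)) (fun n => (E : Matrix (Fin N) (Fin r) ℂ) n c')) : Fin r → Polynomial ℂ) (Prod.fst p)))))) :=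
    hclR_finrank_vecKrylov r N E wstar
  -- the junk rows annihilate `W`
  have hI : ∀ i ∈ I, ∀ y ∈ W, M i ⬝ᵥ y = 0 := by
    intro i hi y hy
    rw [hIdef, Finset.mem_biUnion] at hi
    obtain ⟨k, hk, hik⟩ := hi
    obtain ⟨m, hm, him⟩ := (hSmem k hk i).1 hik
    have hwk := hle k hk
    induction hy using Submodule.span_induction with
    | mem y hy =>
      obtain ⟨⟨c', m''⟩, rfl⟩ := hy
      have hm'' : (m'' : ℕ) < wstar := m''.2
      have hlt : c k + m + m'' < N := by have := hw k; omega
      have hrow := hclR_fin_strip_row_shift c M H hM (fun n => E n c') i ⟨c k + m + m'', hlt⟩ m''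
        (by simp [him]) (by
          intro k' hk'
          simp only at hk'
          by_contra hcon
          rw [him] at hcon
          have hlt' : c k < c k' := by omega
          have := hgap k k' hlt'
          omega)
      change (M *ᵥ ((((Matrix.transpose (Matrix.of fun i j : Fin (N) => if (i : ℕ) = (j : ℕ) + 1 then (1 : ℂ) else 0)))) ^ (m'' : ℕ) *ᵥ fun n => E n c')) i = 0
      rw [hrow]
      have := hclR_fin_junk_row c E F M X₀ hann hME k (w k) (hw k) (hgap k) (hJ k hk) (m + m'')
        (by omega) c'
      convert this using 2
      exact Fin.ext (by simp [Nat.add_assoc])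
    | zero => simp
    | add y z _ _ hy hz => rw [dotProduct_add, hy, hz, add_zero]
    | smul a y _ hy => rw [dotProduct_smul, hy, smul_zero]
  have := hclR_rows_annihilating_le N M hdet W I hI
  rw [hIcard, hW] at this
  exact this

/-! ### The strip theorem -/

set_option linter.unusedVariables false in
/-- **The strip theorem (G-const dual law for strip generators).**  In the setting of
`stub_gconstDualLaw` with strip generators `G₀ i k = [i = c k]` at strictly increasing in-range cut
rows `c : Fin p → ℕ`, a nonsingular solution forces `r ≤ 2 p - 1` (in particular `r ≤ 2 p`). -/
theorem hclR_gconstDualLaw_strip : ∀ (r N p : ℕ) (c : Fin p → ℕ) (hc : StrictMono c) (hcN : ∀ k, c k < N) (E F : Matrix (Fin N) (Fin r) ℂ) (M : Matrix (Fin N) (Fin N) ℂ) (H : Matrix (Fin N) (Fin p) ℂ) (X₀ : Matrix (Fin r) (Fin r) ℂ) (hE : E.rank = r) (hF : F.rank = r) (hann : ∀ Λ : Matrix (Fin N) (Fin r) ℂ, (∀ k : Fin p, (∑ c' : Fin r, (∑ j : Fin N, (((∑ i : Fin N, (Matrix.of fun (i : Fin N) (k : Fin p) => if (i : ℕ) =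 c k then (1 : ℂ) else 0) i k • (((Matrix.transpose (Matrix.of fun i j : Fin (N) => if (i : ℕ) = (j : ℕ) + 1 then (1 : ℂ) else 0)))) ^ (i : ℕ)) *ᵥ (Λᵀ c')) j) • (((Matrix.transpose (Matrix.of fun i j : Fin (N) => if (i : ℕ) = (j : ℕ) + 1 then (1 : ℂ) else 0)))) ^ (j : ℕ)) *ᵥ (Eᵀ c')) = 0) → Λᵀ * F = 0) (hM : M - (Matrix.of fun i j : Fin N => if (i : ℕ) = (j : ℕ) + 1 then (1 : ℂ) else 0) * M * ((Matrix.of fun i j : Fin N => if (i : ℕ) = (j : ℕ) + 1 then (1 : ℂ) else 0))ᵀ = (Matrix.of fun (i : Fin N) (k : Fin p) => if (i : ℕ) = c k then (1 : ℂ) else 0) * Hᵀ) (hME : M * E = F * X₀) (hdet : M.det ≠ 0), r ≤ 2 * p - 1 := by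
  intro r N p c hc hcN E F M H X₀ hE hF hann hM hME hdet
  classical
  have hrN : r ≤ N := hE ▸ Matrix.rank_le_height E
  rcases Nat.eq_zero_or_pos N with hN0 | hN0
  · omega
  rcases Nat.eq_zero_or_pos p with hp0 | hp0
  · exfalso
    subst hp0
    have hM0 : M = 0 := by
      apply hclR_eq_zero_of_stein M
      have h0 : (Matrix.of fun (i : Fin N) (k : Fin 0) => if (i : ℕ) = c k then (1 : ℂ) else 0) * Hᵀ
          = 0 := by
        ext i j; simp [Matrix.mul_apply]
      rw [h0] at hM
      exact sub_eq_zero.mp hM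
    haveI : Nonempty (Fin N) := ⟨⟨0, hN0⟩⟩
    exact hdet (by rw [hM0, Matrix.det_zero])
  by_cases hr2 : r < 2
  · omega
  push Not at hr2
  -- the lowest cut is row `0`, else row `0` of `M` vanishes
  have hc0 : c ⟨0, hp0⟩ = 0 := by
    by_contra h0
    have hpos : ∀ k, 0 < c k := fun k => by
      have := hc.monotone (show (⟨0, hp0⟩ : Fin p) ≤ k from Nat.zero_le _)
      omega
    apply hdet
    apply Matrix.det_eq_zero_of_row_eq_zero ⟨0, hN0⟩
    intro j
    rw [hclR_strip_entry N p c M H hM]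
    refine Finset.sum_eq_zero (fun k _ => ?_)
    have : ¬ c k ≤ ((⟨0, hN0⟩ : Fin N) : ℕ) := by have := hpos k; dsimp only; omega
    rw [if_neg this]
  -- cuts on `ℕ` (with `cutN i = N` for `i ≥ p`) and the strip widths
  obtain ⟨cutN, hcutN⟩ : ∃ cutN : ℕ → ℕ, ∀ i, cutN i = if h : i < p then c ⟨i, h⟩ else N :=
    ⟨_, fun _ => rfl⟩
  have hcut_fin : ∀ k : Fin p, cutN k = c k := fun k => by rw [hcutN, dif_pos k.2]
  have hcut_p : ∀ i, p ≤ i → cutN i = N := fun i hi => by rw [hcutN, dif_neg (by omega)]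
  have hcut_le : ∀ i, cutN i ≤ N := fun i => by
    by_cases hi : i < p
    · rw [hcutN, dif_pos hi]; exact (hcN _).le
    · rw [hcut_p i (not_lt.mp hi)]
  have hcut_mono : Monotone cutN := by
    intro i j hij
    by_cases hj : j < p
    · have hi : i < p := lt_of_le_of_lt hij hj
      rw [hcutN i, hcutN j, dif_pos hi, dif_pos hj]
      exact hc.monotone (Fin.mk_le_mk.mpr hij)
    · rw [hcut_p j (not_lt.mp hj)]
      exact hcut_le i
  obtain ⟨w, hwdef⟩ : ∃ w : Fin p → ℕ, ∀ k, w k = cutN (k + 1) - c k := ⟨_, fun _ => rfl⟩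
  have hcw : ∀ k : Fin p, c k + w k = cutN (k + 1) ∧ 1 ≤ w k := by
    intro k
    have hlt : c k < cutN (k + 1) := by
      by_cases hk : (k : ℕ) + 1 < p
      · rw [hcutN, dif_pos hk]
        exact hc (Fin.mk_lt_mk.mpr (by simp))
      · rw [hcut_p _ (not_lt.mp hk)]; exact hcN k
    rw [hwdef]; omega
  have hwN : ∀ k, c k + w k ≤ N := fun k => (hcw k).1 ▸ hcut_le _
  have hgap : ∀ k k' : Fin p, c k < c k' → c k + w k ≤ c k' := by
    intro k k' hkk'
    have hlt : k < k' := hc.lt_iff_lt.mp hkk'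
    rw [(hcw k).1, ← hcut_fin k']
    exact hcut_mono (Nat.succ_le_of_lt hlt)
  have hsum : ∑ k, w k = N := by
    have h1 : ∑ k : Fin p, w k = ∑ i ∈ Finset.range p, (cutN (i + 1) - cutN i) := by
      rw [← Fin.sum_univ_eq_sum_range]
      exact Finset.sum_congr rfl (fun k _ => by rw [hwdef, hcut_fin])
    have h2 : cutN 0 = 0 := by rw [hcutN, dif_pos hp0]; exact hc0
    rw [h1, Finset.sum_range_tsub hcut_mono, hcut_p p le_rfl, h2, Nat.sub_zero]
  -- the polynomial frame `e` and its capacity / Krylov profiles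
  obtain ⟨e, he⟩ : ∃ e : Fin r → Polynomial ℂ, ((fun c' => (((Polynomial.degreeLT ℂ (N)).subtype ∘ₗ (Polynomial.degreeLTEquiv ℂ (N)).symm.toLinearMap : (Fin (N) → ℂ) →ₗ[ℂ] Polynomial ℂ)) (fun n => (E : Matrix (Fin N) (Fin r) ℂ) n c'))) = e := ⟨_, rfl⟩
  have hli : LinearIndependent ℂ e := he ▸ hclR_polyE_linearIndependent r N E hE
  obtain ⟨cap, hcap⟩ : ∃ cap : ℕ → ℕ, ∀ j, cap j =
      if j = 0 then 1 else j - Module.finrank ℂ ↥((⨆ b : Fin r, Submodule.map (LinearMap.proj b : (Fin r → Polynomial ℂ) →ₗ[ℂ] Polynomial ℂ) (LinearMap.ker (∑ c : Fin r, LinearMap.comp (Polynomial.lsum (fun (i : ℕ) => LinearMap.smulRight (LinearMap.id : ℂ →ₗ[ℂ] ℂ) (Polynomial.divX^[i] (e c : Polynomial ℂ))) : Polynomial ℂ →ₗ[ℂ] Polynomial ℂ) (LinearMap.proj c : (Fin r → Polynomial ℂ) →ₗ[ℂ] Polynomial ℂ)) ⊓ (Submodule.pi Set.univ (fun _ : Fin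 r => Polynomial.degreeLT ℂ (j)) : Submodule ℂ (Fin r → Polynomial ℂ))))) := ⟨_, fun _ => rfl⟩
  obtain ⟨kap, hkap⟩ : ∃ kap : ℕ → ℕ, ∀ j, kap j = Module.finrank ℂ ↥((Submodule.span ℂ (Set.range (fun p : Fin (r) × Fin (j) => Polynomial.divX^[(Prod.snd p).val] ((e : Fin r → Polynomial ℂ) (Prod.fst p)))))) :=
    ⟨_, fun _ => rfl⟩
  have hSle : ∀ j, Module.finrank ℂ ↥((⨆ b : Fin r, Submodule.map (LinearMap.proj b : (Fin r → Polynomial ℂ) →ₗ[ℂ] Polynomial ℂ) (LinearMap.ker (∑ c : Fin r, LinearMap.comp (Polynomial.lsum (fun (i : ℕ) => LinearMap.smulRight (LinearMap.id : ℂ →ₗ[ℂ] ℂ) (Polynomial.divX^[i] (e c : Polynomial ℂ))) : Polynomial ℂ →ₗ[ℂ] Polynomial ℂ) (LinearMap.proj c : (Fin r → Polynomial ℂ) →ₗ[ℂ] Polynomial ℂ)) ⊓ (Submodule.pi Set.univ (fun _ : Fin r => Polynomial.degreeLT ℂ (j)) : Submodule ℂ (Fin r → Polynomial ℂ))))) ≤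 j := by
    intro j
    haveI := (hclR_finrank_degreeLT j).1
    calc _ ≤ Module.finrank ℂ ↥(Polynomial.degreeLT ℂ j) :=
          Submodule.finrank_mono (hclR_SL_le_degreeLT e j)
      _ = j := (hclR_finrank_degreeLT j).2
  have hjunk_of_cap : ∀ j, cap j = 0 → 1 ≤ j ∧ (⨆ b : Fin r, Submodule.map (LinearMap.proj b : (Fin r → Polynomial ℂ) →ₗ[ℂ] Polynomial ℂ) (LinearMap.ker (∑ c : Fin r, LinearMap.comp (Polynomial.lsum (fun (i : ℕ) => LinearMap.smulRight (LinearMap.id : ℂ →ₗ[ℂ] ℂ) (Polynomial.divX^[i] (e c : Polynomial ℂ))) : Polynomial ℂ →ₗ[ℂ] Polynomial ℂ) (LinearMap.proj c : (Fin r → Polynomial ℂ) →ₗ[ℂ] Polynomial ℂ)) ⊓ (Submodule.pi Set.univ (fun _ : Fin r => Polynomial.degreeLT ℂ (j)) : Submodule ℂ (Fin r → Polynomial ℂ)))) = Polynomial.degreeLT ℂ j := by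
    intro j hj
    rw [hcap] at hj
    by_cases hj0 : j = 0
    · rw [if_pos hj0] at hj; exact absurd hj one_ne_zero
    rw [if_neg hj0] at hj
    refine ⟨Nat.pos_of_ne_zero hj0, ?_⟩
    haveI := (hclR_finrank_degreeLT j).1
    apply Submodule.eq_of_le_of_finrank_le (hclR_SL_le_degreeLT e j)
    rw [(hclR_finrank_degreeLT j).2]
    have := hSle j
    omega
  have hcap_of_junk : ∀ j, 1 ≤ j → (⨆ b : Fin r, Submodule.map (LinearMap.proj b : (Fin r → Polynomial ℂ) →ₗ[ℂ] Polynomial ℂ) (LinearMap.ker (∑ c : Fin r, LinearMap.comp (Polynomial.lsum (fun (i : ℕ) => LinearMap.smulRight (LinearMap.id : ℂ →ₗ[ℂ] ℂ) (Polynomial.divX^[i] (e c : Polynomial ℂ))) : Polynomial ℂ →ₗ[ℂ] Polynomial ℂ) (LinearMap.proj c : (Fin r → Polynomial ℂ) →ₗ[ℂ] Polynomial ℂ)) ⊓ (Submodule.pi Set.univ (fun _ : Fin r => Polynomial.degreeLT ℂ (j)) : Submodule ℂ (Fin r → Polynomial ℂ)))) = Polynomial.degreeLT ℂ j → cap j =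 0 := by
    intro j hj hS
    rw [hcap, if_neg (by omega), hS, (hclR_finrank_degreeLT j).2, Nat.sub_self]
  -- (Mono)
  have hMono : ∀ j j', j ≤ j' → cap j = 0 → cap j' = 0 := by
    intro j j' hjj' hj
    obtain ⟨hj1, hS⟩ := hjunk_of_cap j hj
    obtain ⟨d, rfl⟩ := Nat.exists_eq_add_of_le hjj'
    have key : ∀ d, (⨆ b : Fin r, Submodule.map (LinearMap.proj b : (Fin r → Polynomial ℂ) →ₗ[ℂ] Polynomial ℂ) (LinearMap.ker (∑ c : Fin r, LinearMap.comp (Polynomial.lsum (fun (i : ℕ) => LinearMap.smulRight (LinearMap.id : ℂ →ₗ[ℂ] ℂ) (Polynomial.divX^[i] (e c : Polynomial ℂ))) : Polynomial ℂ →ₗ[ℂ] Polynomial ℂ) (LinearMap.proj c : (Fin r → Polynomial ℂ) →ₗ[ℂ] Polynomial ℂ)) ⊓ (Submodule.pi Set.univ (fun _ : Fin r => Polynomial.degreeLT ℂ (j + d)) : Submodule ℂ (Fin r → Polynomial ℂ)))) = Polynomial.degreeLT ℂ (j + d) := by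
      intro d
      induction d with
      | zero => simpa using hS
      | succ d ih => exact hclR_SL_full_succ e (j + d) (by omega) ih
    exact hcap_of_junk (j + d) (by omega) (key d)
  -- (I)
  have hI : ∀ j, 1 ≤ j → 0 < cap j → r * (cap j + j) ≤ 2 * kap j := by
    intro j hj hpos
    rw [hcap, if_neg (by omega)] at hpos ⊢
    rw [hkap]
    set sj := Module.finrank ℂ ↥((⨆ b : Fin r, Submodule.map (LinearMap.proj b : (Fin r → Polynomial ℂ) →ₗ[ℂ] Polynomial ℂ) (LinearMap.ker (∑ c : Fin r, LinearMap.comp (Polynomial.lsum (fun (i : ℕ) => LinearMap.smulRight (LinearMap.id : ℂ →ₗ[ℂ] ℂ) (Polynomial.divX^[i] (e c : Polynomial ℂ))) : Polynomial ℂ →ₗ[ℂ] Polynomial ℂ) (LinearMap.proj c : (Fin r → Polynomial ℂ) →ₗ[ℂ] Polynomial ℂ)) ⊓ (Submodule.pi Set.univ (fun _ : Fin r => Polynomial.degreeLT ℂ (j)) : Submodule ℂ (Fin r → Polynomial ℂ))))) with hsj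
    have hlt : sj < j := by omega
    have h := hclR_capacity_ineq e hr2 hli j hj hlt
    set d := j - sj with hd
    have hdj : j = sj + d := by omega
    have e3 : r * j = r * sj + r * d := by rw [← mul_add, ← hdj]
    have e4 : 2 * r * j = 2 * (r * j) := by ring
    rw [e4] at h
    nlinarith [h, e3]
  -- (C) : `r = rank F ≤ Σ_k cap (w k)` (G1 + G2)
  have hwk : ∀ k : Fin p, cutN ((Fin.succ k : Fin (p + 1)) : ℕ) -
      cutN ((Fin.castSucc k : Fin (p + 1)) : ℕ) = w k := by
    intro k
    simp only [Fin.val_succ, Fin.val_castSucc, hcut_fin, hwdef]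
  have hC : r ≤ ∑ k, cap (w k) := by
    have hG2 := hclR_strip_rank_le_sum_cap r N p (fun k => cutN k) (fun i j hij => hcut_mono hij)
      (by simpa using (show cutN 0 = 0 by rw [hcutN, dif_pos hp0]; exact hc0))
      (by simpa using hcut_p p le_rfl) (fun k => hcut_le k) E F (by
        intro k α hα b a
        have hG1 := hclR_strip_block_orth r N p c E F hann k _ (by rw [hwk]; exact hwN k)
          (by rw [hwk]; exact hgap k) α hα b a
        convert hG1 using 4
        simp [hcut_fin])
    rw [hF, he] at hG2
    refine hG2.trans (le_of_eq (Finset.sum_congr rfl (fun k _ => ?_)))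
    rw [hwk k, hcap, if_neg (by have := (hcw k).2; omega)]
  -- (II)
  have hII : ∀ wstar : ℕ, 1 ≤ wstar → (∀ k, cap (w k) = 0 → wstar ≤ w k) →
      (∑ k ∈ Finset.univ.filter (fun k => cap (w k) = 0), (w k + 1 - wstar)) + kap wstar ≤ N := by
    intro wstar hws hprem
    rw [hkap]
    have hJ' : ∀ k ∈ Finset.univ.filter (fun k => cap (w k) = 0),
        (⨆ b : Fin r, Submodule.map (LinearMap.proj b : (Fin r → Polynomial ℂ) →ₗ[ℂ] Polynomial ℂ) (LinearMap.ker (∑ c : Fin r, LinearMap.comp (Polynomial.lsum (fun (i : ℕ) => LinearMap.smulRight (LinearMap.id : ℂ →ₗ[ℂ] ℂ) (Polynomial.divX^[i] ((fun c' => (((Polynomial.degreeLT ℂ (N)).subtype ∘ₗ (Polynomial.degreeLTEquiv ℂ (N)).symm.toLinearMap : (Fin (N) → ℂ) →ₗ[ℂ] Polynomial ℂ)) (fun n => (E : Matrix (Fin N) (Fin r) ℂ) n c')) c : Polynomial ℂ))) : Polynomial ℂ →ₗ[ℂ] Polynomial ℂ) (LinearMap.proj c : (Fin r → Polynomial ℂ)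 →ₗ[ℂ] Polynomial ℂ)) ⊓ (Submodule.pi Set.univ (fun _ : Fin r => Polynomial.degreeLT ℂ (w k)) : Submodule ℂ (Fin r → Polynomial ℂ)))) = Polynomial.degreeLT ℂ (w k) := by
      intro k hk
      rw [he]
      exact (hjunk_of_cap _ (by simpa using hk)).2
    have hle' : ∀ k ∈ Finset.univ.filter (fun k => cap (w k) = 0), wstar ≤ w k :=
      fun k hk => hprem k (by simpa using hk)
    have := hclR_fin_junk_count c E F M H X₀ hann hM hME hdet hc w hwN hgap hN0 _ hJ' wstar hws hle'
    rw [he] at this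
    exact this
  exact hclR_strip_endgame_pos p r N w cap kap hr2 (fun k => (hcw k).2) hsum hI hMono hC hII

end Summit.MatrixMultiplication.MatrixMultiplication.Theorems
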